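import Literature.AlgebraicGeometry.ComplexMultiplication.CyclotomicFermatCMTypesPrimePowerLevelSimple
import HarnessLib

/-!
# Koblitz–Rohrlich, §3 "The boundary cases when `N` is prime to six": the PROPOSITION (`H_τ = H_{τ′} ⟹ τ′ a permutation of τ`, all
# triples, relatively prime or not) IN FULL at `N = 25` and `N = 35` by kernel enumeration

Layer `Literature/AlgebraicGeometry/ComplexMultiplication`, namespace `…ComplexMultiplication.CyclotomicFermatCMType`; sequel of
`CyclotomicFermatCMTypesPrimePowerLevelSimple` (the relatively prime case at prime-power levels; the scaling lemma
`mem_fermatCMType_mul_iff_of_isUnit`).  THEOREMS ONLY (no definition, no named fact, no `sorry`): two kernel computations (`decide`) over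
all pairs (normalised triple through `1`, arbitrary second triple) and the printed normalisation glue.

THE SOURCE.  N. Koblitz, D. Rohrlich, *Simple factors in the Jacobian of a Fermat curve*, Canad. J. Math. **30** (1978) 1183–1205, §3
(p. 1193): "The boundary cases when `N` is prime to six.  To prove Theorem 1, it remains to establish the following proposition.
PROPOSITION. Let `2, 3 ∤ N`, `τ = (r, s, t)`, `τ′ = (r′, s′, t′)`, `r + s + t = N`.  Suppose g.c.d.`(r, s, t, r′, s′, t′) = 1`.  Let
`H_τ = {h ∈ (ℤ/Nℤ)* | ⟨hr⟩ + ⟨hs⟩ + ⟨ht⟩ = N}` and similarly for `H_{τ′}`.  Suppose `N` is not prime to `rstr′s′t′`.  In the case that `r = r′`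
for some ordering of the triples `τ` and `τ′`, suppose further that `N` is not prime to `sts′t′`.  Finally, suppose `H_τ = H_{τ′}`.  Then `τ′` is
a permutation of `τ`."  (Proof: pp. 1193–1197, Cases 1–3 and a Lemma, p. 1195.)  With §2 (the relatively prime case, "if `H_{r,s,t} =
H_{r′,s′,t′}` then `{r, s, t} = {r′, s′, t′}`", p. 1187) this is Theorem 1 (i) at every level prime to `6`.

WHAT IS PROVED — the conclusion "τ′ is a permutation of τ" for ALL pairs of triples of non-zero residues (sums `0`) with `H_τ = H_{τ′}`,
relatively prime AND boundary, without the technical proviso, at the two smallest composite levels prime to `6`: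

* §1 (any level `N`): the normalisation glue — if the conclusion holds for every pair whose first triple is `(1, s, −1−s)`, it holds for every
  pair one of whose six entries is a unit (`multiset_eq_of_fermatCMType_eq_of_normalised`: scale by the inverse of the unit entry, permute
  it to the front; `H_{uτ} = {x : ux ∈ H_τ}` for any triple, tree `mem_fermatCMType_mul_iff_of_isUnit`).
* §2 `N = 25`: `fermatCMType_eq_imp_multiset_eq_twentyFive_normalised` (kernel enumeration, `24·25²` cases) and
  **`multiset_eq_of_fermatCMType_eq_twentyFive`**: for triples of non-zero residues modulo `25` with sums `0`, one entry of the six a unit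
  (⟺ g.c.d.`(r,s,t,r′,s′,t′,25) = 1`), `H_{τ′} = H_τ ⟹ {r′,s′,t′} = {r,s,t}`.
* §3 `N = 35`: the same (`…_thirtyFive_normalised`, **`multiset_eq_of_fermatCMType_eq_thirtyFive`**), plus the remaining configuration with
  g.c.d. `1` and NO unit entry — `τ ⊂ 5ℤ/35`, `τ′ ⊂ 7ℤ/35` — where `H_τ ≠ H_{τ′}` always (`fermatCMType_ne_of_five_seven_thirtyFive`), so that
  at `35` too EVERY coincidence with g.c.d. `1` is a permutation.

## Honest column / NOT here

* The general Proposition (all `N` prime to `6`) and its proof are NOT typed; `25 = 5²` and `35 = 5·7` only.  The statements here are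
  stronger than printed at these levels (no "not prime to `rstr′s′t′`" / "`r = r′`" provisos: the relatively prime case is included, where
  the conclusion is §2's).
* K–R's triples have entries in `[1, N−1]` with `r + s + t = N`; here: non-zero residues with `r + s + t ≡ 0` (both lifts `N`, `2N`).
* "g.c.d. `= 1`" is typed at `25` as "some entry is a unit" and at `35` as that OR the `5ℤ × 7ℤ` configuration (the only other one with
  non-zero entries, sums `0` and g.c.d. `1` — an elementary remark recorded in the docstrings, not as a theorem).
* Kernel `decide` only (`maxRecDepth 100000`; the level-`35` enumeration is the largest in this series).  Private: `map_mul_triple'`,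
  `isUnit_iff_val_coprime₁₁`, `multiset_eq_of_normalised_of_isUnit_fst`.

## References

* [KoblitzRohrlich1978] N. Koblitz, D. Rohrlich, Canad. J. Math. 30 (1978) 1183–1205: §3 Proposition (p. 1193), §2 (p. 1187), Theorem 1
  (p. 1185).

## Provenance

Cell `pub-hodgecm2` (COR-CM), literature seat `lit-deligne-3` gen 35 (claim KR78-BOUNDARY-INSTANCES; count-neutral, own lane).
-/

open NumberField

namespace Literature.AlgebraicGeometry.ComplexMultiplication

open Literature.AlgebraicGeometry.HodgeTheory

namespace CyclotomicFermatCMType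

/-! ## §1 Any level: from pairs with first triple `(1, s, −1−s)` to pairs with a unit entry -/

section Glue

variable {N : ℕ} [NeZero N]

/-- The image of a triple under multiplication by `c` (private copy). [folklore] -/
private theorem map_mul_triple' {α : Type*} [Mul α] (c x y z : α) :
    (({x, y, z} : Multiset α).map (fun w => c * w)) = {c * x, c * y, c * z} := by
  simp only [Multiset.insert_eq_cons, Multiset.map_cons, Multiset.map_singleton]

/-- Units of `ℤ/N` are the residues with value prime to `N` (private copy of the siblings'). [folklore] -/
private theorem isUnit_iff_val_coprime₁₁ (x : ZMod N) : IsUnit x ↔ x.val.Coprime N := by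
  conv_lhs => rw [← ZMod.natCast_zmod_val x]
  exact ZMod.isUnit_iff_coprime x.val N

/-- The glue when the FIRST entry of `τ` is a unit: scale by its inverse ("we may assume that the pair is actually `(1, s)`").
[cite: KoblitzRohrlich1978, §1 (p. 1184) and §3 (p. 1193)] -/
private theorem multiset_eq_of_normalised_of_isUnit_fst
    (S : ∀ s r' s' : ZMod N, s ≠ 0 → (-1 - s : ZMod N) ≠ 0 → r' ≠ 0 → s' ≠ 0 → (-r' - s' : ZMod N) ≠ 0 →
      fermatCMType N r' s' (-r' - s') = fermatCMType N 1 s (-1 - s) →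
      ({r', s', -r' - s'} : Multiset (ZMod N)) = {1, s, -1 - s})
    {r s t r' s' t' : ZMod N} (hr : IsUnit r) (hs : s ≠ 0) (ht : t ≠ 0) (hrst : r + s + t = 0)
    (hr' : r' ≠ 0) (hs' : s' ≠ 0) (ht' : t' ≠ 0) (hrst' : r' + s' + t' = 0)
    (heq : fermatCMType N r' s' t' = fermatCMType N r s t) :
    ({r', s', t'} : Multiset (ZMod N)) = {r, s, t} := by
  obtain rfl : t = -r - s := by linear_combination hrst
  obtain rfl : t' = -r' - s' := by linear_combination hrst'
  obtain ⟨ri, hri⟩ := hr.exists_right_inv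
  have hri' : IsUnit ri := IsUnit.of_mul_eq_one_right r hri
  obtain ⟨riu, hriu⟩ := hri'
  have hnz : ∀ {x : ZMod N}, x ≠ 0 → ri * x ≠ 0 := by
    intro x hx h
    apply hx
    have := congrArg (fun y => r * y) h
    simpa only [← mul_assoc, hri, one_mul, mul_zero] using this
  have e₁ : ri * (-r - s) = -1 - ri * s := by linear_combination (-1 : ZMod N) * hri
  have e₂ : ri * (-r' - s') = -(ri * r') - ri * s' := by ring
  have key : fermatCMType N (ri * r') (ri * s') (ri * (-r' - s')) = fermatCMType N (ri * r) (ri * s) (ri * (-r - s)) := by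
    ext x
    rw [mem_fermatCMType_mul_iff_of_isUnit ⟨riu, hriu⟩, mem_fermatCMType_mul_iff_of_isUnit ⟨riu, hriu⟩, heq]
  rw [show ri * r = 1 from by rw [mul_comm]; exact hri, e₁, e₂] at key
  have c₂ : (-1 - ri * s : ZMod N) ≠ 0 := by rw [← e₁]; exact hnz ht
  have c₅ : (-(ri * r') - ri * s' : ZMod N) ≠ 0 := by rw [← e₂]; exact hnz ht'
  have hu := S (ri * s) (ri * r') (ri * s') (hnz hs) c₂ (hnz hr') (hnz hs') c₅ key
  have hu' := congrArg (Multiset.map (fun w => r * w)) hu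
  rwa [map_mul_triple', map_mul_triple', show r * (ri * r') = r' by linear_combination r' * hri,
    show r * (ri * s') = s' by linear_combination s' * hri,
    show r * (-(ri * r') - ri * s') = -r' - s' by linear_combination (-r' - s') * hri, mul_one,
    show r * (ri * s) = s by linear_combination s * hri,
    show r * (-1 - ri * s) = -r - s by linear_combination (-s) * hri] at hu'

/-- **The normalisation glue** (any level `N`): if every coincidence `H_{τ′} = H_{(1,s,−1−s)}` (non-zero entries) forces `{τ′} = {1, s, −1−s}`,
then for ALL triples `τ, τ′` of non-zero residues with sums `0` and a unit among the six entries, `H_{τ′} = H_τ` forces `{τ′} = {τ}` — scale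
by the inverse of the unit entry and permute it to the front (`H` depends on the multiset only), swapping the roles of `τ, τ′` if needed.
[cite: KoblitzRohrlich1978, §1 (p. 1184) and §3 Proposition (p. 1193)] -/
theorem multiset_eq_of_fermatCMType_eq_of_normalised
    (S : ∀ s r' s' : ZMod N, s ≠ 0 → (-1 - s : ZMod N) ≠ 0 → r' ≠ 0 → s' ≠ 0 → (-r' - s' : ZMod N) ≠ 0 →
      fermatCMType N r' s' (-r' - s') = fermatCMType N 1 s (-1 - s) →
      ({r', s', -r' - s'} : Multiset (ZMod N)) = {1, s, -1 - s})
    {r s t r' s' t' : ZMod N} (hr : r ≠ 0) (hs : s ≠ 0) (ht : t ≠ 0) (hrst : r + s + t = 0)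
    (hr' : r' ≠ 0) (hs' : s' ≠ 0) (ht' : t' ≠ 0) (hrst' : r' + s' + t' = 0)
    (hunit : IsUnit r ∨ IsUnit s ∨ IsUnit t ∨ IsUnit r' ∨ IsUnit s' ∨ IsUnit t')
    (heq : fermatCMType N r' s' t' = fermatCMType N r s t) :
    ({r', s', t'} : Multiset (ZMod N)) = {r, s, t} := by
  -- the three permutations used to move an entry to the front
  have p12 : ∀ a b c : ZMod N, ({a, b, c} : Multiset (ZMod N)) = {b, a, c} := fun a b c => by
    rw [Multiset.insert_eq_cons, Multiset.insert_eq_cons, Multiset.insert_eq_cons, Multiset.insert_eq_cons, Multiset.cons_swap]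
  have p23 : ∀ a b c : ZMod N, ({a, b, c} : Multiset (ZMod N)) = {a, c, b} := fun a b c => by
    rw [Multiset.pair_comm b c]
  have p13 : ∀ a b c : ZMod N, ({a, b, c} : Multiset (ZMod N)) = {c, b, a} := fun a b c => by
    rw [p23 a b c, p12 a c b, p23 c a b]
  rcases hunit with hu | hu | hu | hu | hu | hu
  · exact multiset_eq_of_normalised_of_isUnit_fst S hu hs ht hrst hr' hs' ht' hrst' heq
  · -- `s` a unit: permute `τ` to `(s, r, t)`
    rw [p12 r s t]
    refine multiset_eq_of_normalised_of_isUnit_fst S hu hr ht (by linear_combination hrst) hr' hs' ht' hrst' ?_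
    rw [heq]; exact fermatCMType_eq_of_multiset_eq (p12 r s t)
  · -- `t` a unit: permute `τ` to `(t, s, r)`
    rw [p13 r s t]
    refine multiset_eq_of_normalised_of_isUnit_fst S hu hs hr (by linear_combination hrst) hr' hs' ht' hrst' ?_
    rw [heq]; exact fermatCMType_eq_of_multiset_eq (p13 r s t)
  · exact (multiset_eq_of_normalised_of_isUnit_fst S hu hs' ht' hrst' hr hs ht hrst heq.symm).symm
  · rw [p12 r' s' t']
    refine (multiset_eq_of_normalised_of_isUnit_fst S hu hr' ht' (by linear_combination hrst') hr hs ht hrst ?_).symm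
    rw [← heq]; exact fermatCMType_eq_of_multiset_eq (p12 r' s' t')
  · rw [p13 r' s' t']
    refine (multiset_eq_of_normalised_of_isUnit_fst S hu hs' hr' (by linear_combination hrst') hr hs ht hrst ?_).symm
    rw [← heq]; exact fermatCMType_eq_of_multiset_eq (p13 r' s' t')

end Glue

/-! ## §2 `N = 25` -/

section TwentyFive

set_option maxHeartbeats 400000 in
set_option maxRecDepth 100000 in
/-- **Enumeration at `N = 25`, normalised form**: for `s, −1−s, r′, s′, −r′−s′` non-zero modulo `25` (no unit hypothesis on `s`: boundary
triples such as `(1, 4, 20)` included), `H_{(r′,s′,−r′−s′)} = H_{(1,s,−1−s)}` forces `{r′, s′, −r′−s′} = {1, s, −1−s}` (kernel computation over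
all `25³` cases). [cite: KoblitzRohrlich1978, §3 Proposition (p. 1193) and §2 (p. 1187)] -/
theorem fermatCMType_eq_imp_multiset_eq_twentyFive_normalised :
    ∀ s r' s' : ZMod 25, s ≠ 0 → (-1 - s : ZMod 25) ≠ 0 → r' ≠ 0 → s' ≠ 0 → (-r' - s' : ZMod 25) ≠ 0 →
      fermatCMType 25 r' s' (-r' - s') = fermatCMType 25 1 s (-1 - s) →
      ({r', s', -r' - s'} : Multiset (ZMod 25)) = {1, s, -1 - s} := by
  decide

/-- **K–R's §3 PROPOSITION together with THEOREM 1 (i), IN FULL at `N = 25`**: for triples `τ = (r,s,t)`, `τ′ = (r′,s′,t′)` of non-zero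
residues modulo `25` with `r + s + t = r′ + s′ + t′ = 0` and g.c.d.`(r, s, t, r′, s′, t′, 25) = 1` (i.e. one of the six entries a unit),
`H_{τ′} = H_τ` implies that `τ′` is a permutation of `τ` — relatively prime case AND boundary cases.
[cite: KoblitzRohrlich1978, §3 Proposition (p. 1193), §2 (p. 1187) and Theorem 1 (i) (p. 1185)] -/
theorem multiset_eq_of_fermatCMType_eq_twentyFive {r s t r' s' t' : ZMod 25} (hr : r ≠ 0) (hs : s ≠ 0) (ht : t ≠ 0)
    (hrst : r + s + t = 0) (hr' : r' ≠ 0) (hs' : s' ≠ 0) (ht' : t' ≠ 0) (hrst' : r' + s' + t' = 0)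
    (hunit : IsUnit r ∨ IsUnit s ∨ IsUnit t ∨ IsUnit r' ∨ IsUnit s' ∨ IsUnit t')
    (heq : fermatCMType 25 r' s' t' = fermatCMType 25 r s t) :
    ({r', s', t'} : Multiset (ZMod 25)) = {r, s, t} :=
  multiset_eq_of_fermatCMType_eq_of_normalised fermatCMType_eq_imp_multiset_eq_twentyFive_normalised hr hs ht hrst hr' hs' ht'
    hrst' hunit heq

/-- A boundary-case witness at `25`: the triple `(1, 4, 20)` (with the non-unit entry `20`) has `H_{1,4,20} = {1,2,3,4,7,8,9,13,14,19}` — the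
statement above is not only about unit triples (kernel computation). [cite: KoblitzRohrlich1978, §3 (p. 1193)] -/
theorem fermatCMType_twentyFive_one_four_twenty : fermatCMType 25 1 4 20 = {1, 2, 3, 4, 7, 8, 9, 13, 14, 19} := by
  decide

end TwentyFive

/-! ## §3 `N = 35` -/

section ThirtyFive

set_option maxRecDepth 100000 in
set_option maxHeartbeats 4000000 in
/-- **Enumeration at `N = 35`, normalised form**: for `s, −1−s, r′, s′, −r′−s′` non-zero modulo `35`, `H_{(r′,s′,−r′−s′)} = H_{(1,s,−1−s)}`
forces `{r′, s′, −r′−s′} = {1, s, −1−s}` (kernel computation over all `35³` cases). [cite: KoblitzRohrlich1978, §3 Proposition (p. 1193) and §2 (p. 1187)] -/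
theorem fermatCMType_eq_imp_multiset_eq_thirtyFive_normalised :
    ∀ s r' s' : ZMod 35, s ≠ 0 → (-1 - s : ZMod 35) ≠ 0 → r' ≠ 0 → s' ≠ 0 → (-r' - s' : ZMod 35) ≠ 0 →
      fermatCMType 35 r' s' (-r' - s') = fermatCMType 35 1 s (-1 - s) →
      ({r', s', -r' - s'} : Multiset (ZMod 35)) = {1, s, -1 - s} := by
  decide

/-- **K–R's §3 PROPOSITION together with THEOREM 1 (i) at `N = 35`, pairs with a unit entry**: for triples of non-zero residues modulo `35`
with sums `0` and one of the six entries a unit, `H_{τ′} = H_τ` implies that `τ′` is a permutation of `τ`.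
[cite: KoblitzRohrlich1978, §3 Proposition (p. 1193), §2 (p. 1187) and Theorem 1 (i) (p. 1185)] -/
theorem multiset_eq_of_fermatCMType_eq_thirtyFive {r s t r' s' t' : ZMod 35} (hr : r ≠ 0) (hs : s ≠ 0) (ht : t ≠ 0)
    (hrst : r + s + t = 0) (hr' : r' ≠ 0) (hs' : s' ≠ 0) (ht' : t' ≠ 0) (hrst' : r' + s' + t' = 0)
    (hunit : IsUnit r ∨ IsUnit s ∨ IsUnit t ∨ IsUnit r' ∨ IsUnit s' ∨ IsUnit t')
    (heq : fermatCMType 35 r' s' t' = fermatCMType 35 r s t) :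
    ({r', s', t'} : Multiset (ZMod 35)) = {r, s, t} :=
  multiset_eq_of_fermatCMType_eq_of_normalised fermatCMType_eq_imp_multiset_eq_thirtyFive_normalised hr hs ht hrst hr' hs' ht'
    hrst' hunit heq

set_option maxRecDepth 100000 in
set_option synthInstance.maxHeartbeats 400000 in
set_option synthInstance.maxSize 100000 in
/-- **The remaining configuration with g.c.d. `1` at `35`**: a triple of non-zero residues with sum `0` and no unit entry lies in `5ℤ/35`
(`7x = 0`) or in `7ℤ/35` (`5x = 0`) (two multiples of `5` and one of `7` cannot sum to `0` with non-zero entries); for `τ ⊂ 5ℤ/35` and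
`τ′ ⊂ 7ℤ/35` the sets never coincide: `H_{τ′} ≠ H_τ` (kernel computation) — so at `35` EVERY coincidence `H_{τ′} = H_τ` with
g.c.d.`(r,s,t,r′,s′,t′,35) = 1` is a permutation (K–R's Case 1, "g.c.d.`(r, s, t, N) > 1`").
[cite: KoblitzRohrlich1978, §3 Proposition, Case 1 (p. 1193)] -/
theorem fermatCMType_ne_of_five_seven_thirtyFive :
    ∀ x : ZMod 35, 7 * x = 0 → x ≠ 0 → ∀ y : ZMod 35, 7 * y = 0 → y ≠ 0 → (-x - y : ZMod 35) ≠ 0 →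
      ∀ x' : ZMod 35, 5 * x' = 0 → x' ≠ 0 → ∀ y' : ZMod 35, 5 * y' = 0 → y' ≠ 0 → (-x' - y' : ZMod 35) ≠ 0 →
      fermatCMType 35 x' y' (-x' - y') ≠ fermatCMType 35 x y (-x - y) := by
  decide

end ThirtyFive

end CyclotomicFermatCMType

end Literature.AlgebraicGeometry.ComplexMultiplication
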